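import Summits.CriticalPhenomena.PercolationContinuityZ3.Theorems.PercNearOneGluingNoHeavyQuantUniversalCertificate
import Summits.CriticalPhenomena.PercolationContinuityZ3.Theorems.PercNearOneGluingNoHeavyQuantRegimeRCert
import Summits.CriticalPhenomena.PercolationContinuityZ3.Theorems.PercNearOneGluingNoHeavyQuantTwoLayerHalfPointwise
import Summits.CriticalPhenomena.PercolationContinuityZ3.Theorems.PercNearOneGluingNoHeavyQuantTwoLayerHalfRows
import Summits.CriticalPhenomena.PercolationContinuityZ3.Theorems.PercNearOneGluingNoHeavyQuantTwoLayerHalfNeed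
import Summits.CriticalPhenomena.PercolationContinuityZ3.Theorems.PercNearOneGluingNoHeavyQuantDeepLowsGiants
import HarnessLib

/-!
# QUANT lane R8, heavy node: every row `d ≥ qT₂` (the second factor's gated target) of the conclusion of `LawDec.TLBGateConvClosedHeavy`
# holds (`LawDec.gate_lconv_row_of_ge_right`) — regime R = arm-2's S* of factor 1 + weight-1 reflections `c = 0` on the rows above `d`

builds on p205010 (kernel theorem, internal audit signed; external expert review pending)

Support file (`--supports stmt-CriticalPhenomena-4575`), QUANT lane typer seat prim-quant-stmt (gen 34).  Theorems only, standard axioms,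
no sorries.  Structure: the concrete S* data (`act`, `c`, `need`) and their properties are COPIED from arm-2 g38's assembly
`twoLayer_lconv_of_half_le` (`…QuantTwoLayerHalf`, ⧗ p375979 — its 15-line `need_drop_witness` is restated here as a local `have`), `hS` is arm-2's
`halfCert_pointwise` (`…QuantTwoLayerHalfPointwise`), the packaging is `regimeR_certificate_of_pointwise` (`…QuantRegimeRCert`, ✓ p378849), and the
conclusion is the q-free principle `gate_lconv_row_of_universalCertificate` (`…QuantUniversalCertificate`, ✓ p377956) with zero tilts.
Memo `run/shared/lean/prim/quant/prim-quant-stmt-g34/PHANTOM-QFREE-G34.md` §4.  Together with `gate_lconv_row_of_lt_min` (`…QuantHeavyRegimeM`)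
and `lconv_comm` this gives every row of the conclusion of `LawDec.TLBGateConvClosedHeavy` (assembly: `…QuantHeavyHolds`).
HONEST STATUS: `TLBGateConvClosedHeavy`, `FarTreeRowHeavy`, `FarTreeRow` remain OPEN in the tree until that assembly lands.

[this work]; S*: prim-quant-arm-2 g38.  The gluing rows served [cite: KozmaNitzan2024, Conjecture 3 (p. 15)]; product measure
[cite: Grimmett1999, §1.3 p. 10].
-/

noncomputable section

namespace Summit.CriticalPhenomena.PercolationContinuityZ3.Theorems

namespace Quant

open Finset

namespace LawDec

/-- **ROWS AT OR ABOVE THE SECOND GATED TARGET (regime R of the heavy node).**  In the binder of `LawDec.TLBGateConvClosedHeavy`: for a layer `d`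
with `q·T₂ ≤ d` and `2d < q(T₁+T₂)`, row `d` of `TLB (y/(1−y)) (q(T₁+T₂)) (M₁+M₂) (gate (lconv μ₁ μ₂) q)` holds.  (For `q·T₁ ≤ d` use `lconv_comm`.)
[this work] -/
theorem gate_lconv_row_of_ge_right (y q : ℝ) (M₁ M₂ d : ℕ) (μ₁ μ₂ : ℕ → ℝ)
    (hy : 1 / 2 ≤ y) (hy1 : y < 1) (hq0 : 0 < q) (hq1 : q ≤ 1)
    (n1 : ∀ h, 0 ≤ μ₁ h) (z1 : ∀ h, M₁ < h → μ₁ h = 0) (s1 : ∑ h ∈ Finset.range (M₁ + 1), μ₁ h = 1)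
    (n2 : ∀ h, 0 ≤ μ₂ h) (z2 : ∀ h, M₂ < h → μ₂ h = 0) (s2 : ∑ h ∈ Finset.range (M₂ + 1), μ₂ h = 1)
    (hB1 : ∀ dd : ℕ, 2 * (dd : ℝ) < q * ∑ h ∈ Finset.range (M₁ + 1), (h : ℝ) * μ₁ h →
      y / (1 - y) * ∑ h ∈ Finset.range (dd + 1), gate μ₁ q h
        ≤ ∑ h ∈ Finset.range (M₁ + 1), (if q * (∑ h ∈ Finset.range (M₁ + 1), (h : ℝ) * μ₁ h) - dd ≤ (h : ℝ) then gate μ₁ q h else 0))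
    (hB2 : ∀ dd : ℕ, 2 * (dd : ℝ) < q * ∑ h ∈ Finset.range (M₂ + 1), (h : ℝ) * μ₂ h →
      y / (1 - y) * ∑ h ∈ Finset.range (dd + 1), gate μ₂ q h
        ≤ ∑ h ∈ Finset.range (M₂ + 1), (if q * (∑ h ∈ Finset.range (M₂ + 1), (h : ℝ) * μ₂ h) - dd ≤ (h : ℝ) then gate μ₂ q h else 0))
    (hd2 : q * ∑ h ∈ Finset.range (M₂ + 1), (h : ℝ) * μ₂ h ≤ d)
    (hd : 2 * (d : ℝ) < q * ((∑ h ∈ Finset.range (M₁ + 1), (h : ℝ) * μ₁ h) + ∑ h ∈ Finset.range (M₂ + 1), (h : ℝ) * μ₂ h)) :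
    y / (1 - y) * ∑ h ∈ Finset.range (d + 1), gate (lconv M₁ M₂ μ₁ μ₂) q h
      ≤ ∑ h ∈ Finset.range (M₁ + M₂ + 1),
        (if q * ((∑ h ∈ Finset.range (M₁ + 1), (h : ℝ) * μ₁ h) + ∑ h ∈ Finset.range (M₂ + 1), (h : ℝ) * μ₂ h) - d ≤ (h : ℝ)
          then gate (lconv M₁ M₂ μ₁ μ₂) q h else 0) := by
  classical
  -- a drop of a two-level profile at `c` witnesses a U- or W-cell AT `c` (arm-2 g38, `…QuantTwoLayerHalf`, restated locally)
  have need_drop_witness : ∀ (U W : ℕ → ℕ → Prop) (r : ℝ) (K a c : ℕ),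
      ((if ∃ s' ∈ Finset.Icc c K, U a s' then (1 : ℝ) else if ∃ s' ∈ Finset.Icc c K, W a s' then r else 0)
        ≠ (if ∃ s' ∈ Finset.Icc (c + 1) K, U a s' then (1 : ℝ) else if ∃ s' ∈ Finset.Icc (c + 1) K, W a s' then r else 0)) →
      U a c ∨ W a c := by
    intro U W r K a c hne
    have monoU : (∃ s' ∈ Finset.Icc (c + 1) K, U a s') → (∃ s' ∈ Finset.Icc c K, U a s') := by
      rintro ⟨s', hs', h⟩; rw [Finset.mem_Icc] at hs'; exact ⟨s', Finset.mem_Icc.2 ⟨by omega, hs'.2⟩, h⟩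
    have monoW : (∃ s' ∈ Finset.Icc (c + 1) K, W a s') → (∃ s' ∈ Finset.Icc c K, W a s') := by
      rintro ⟨s', hs', h⟩; rw [Finset.mem_Icc] at hs'; exact ⟨s', Finset.mem_Icc.2 ⟨by omega, hs'.2⟩, h⟩
    have downU : (∃ s' ∈ Finset.Icc c K, U a s') → ¬ (∃ s' ∈ Finset.Icc (c + 1) K, U a s') → U a c := by
      rintro ⟨s', hs', h⟩ hno; rw [Finset.mem_Icc] at hs'
      rcases Nat.eq_or_lt_of_le hs'.1 with heq | hlt
      · exact heq ▸ h
      · exact (hno ⟨s', Finset.mem_Icc.2 ⟨hlt, hs'.2⟩, h⟩).elim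
    have downW : (∃ s' ∈ Finset.Icc c K, W a s') → ¬ (∃ s' ∈ Finset.Icc (c + 1) K, W a s') → W a c := by
      rintro ⟨s', hs', h⟩ hno; rw [Finset.mem_Icc] at hs'
      rcases Nat.eq_or_lt_of_le hs'.1 with heq | hlt
      · exact heq ▸ h
      · exact (hno ⟨s', Finset.mem_Icc.2 ⟨hlt, hs'.2⟩, h⟩).elim
    by_cases hU1 : ∃ s' ∈ Finset.Icc c K, U a s'
    · by_cases hU2 : ∃ s' ∈ Finset.Icc (c + 1) K, U a s'
      · rw [if_pos hU1, if_pos hU2] at hne; exact (hne rfl).elim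
      · exact Or.inl (downU hU1 hU2)
    · have hU2 : ¬ ∃ s' ∈ Finset.Icc (c + 1) K, U a s' := fun h => hU1 (monoU h)
      rw [if_neg hU1, if_neg hU2] at hne
      by_cases hW1 : ∃ s' ∈ Finset.Icc c K, W a s'
      · by_cases hW2 : ∃ s' ∈ Finset.Icc (c + 1) K, W a s'
        · rw [if_pos hW1, if_pos hW2] at hne; exact (hne rfl).elim
        · exact Or.inr (downW hW1 hW2)
      · have hW2 : ¬ ∃ s' ∈ Finset.Icc (c + 1) K, W a s' := fun h => hW1 (monoW h)
        rw [if_neg hW1, if_neg hW2] at hne; exact (hne rfl).elim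
  have e : q * ((∑ h ∈ Finset.range (M₁ + 1), (h : ℝ) * μ₁ h) + ∑ h ∈ Finset.range (M₂ + 1), (h : ℝ) * μ₂ h)
      = q * (∑ h ∈ Finset.range (M₁ + 1), (h : ℝ) * μ₁ h) + q * (∑ h ∈ Finset.range (M₂ + 1), (h : ℝ) * μ₂ h) := by ring
  rw [e] at hd ⊢
  set t₁ : ℝ := q * ∑ h ∈ Finset.range (M₁ + 1), (h : ℝ) * μ₁ h with ht₁
  set t₂ : ℝ := q * ∑ h ∈ Finset.range (M₂ + 1), (h : ℝ) * μ₂ h with ht₂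
  set k : ℕ := d with hkd
  have hy0 : 0 < y := by linarith
  have hk2 : 2 * (k : ℝ) < t₁ + t₂ := hd
  have hR : t₂ ≤ k := hd2
  have hk0 : (0 : ℝ) ≤ k := Nat.cast_nonneg k
  -- `t₁ ≤ T₁ ≤ M₁`, and `0 < t₁` (since `2k < t₁ + t₂ ≤ t₁ + k`)
  have hT₁M : (∑ h ∈ Finset.range (M₁ + 1), (h : ℝ) * μ₁ h) ≤ M₁ := lawMean_le_top M₁ μ₁ n1 s1
  have hT₁0 : 0 ≤ ∑ h ∈ Finset.range (M₁ + 1), (h : ℝ) * μ₁ h :=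
    Finset.sum_nonneg fun h _ => mul_nonneg (Nat.cast_nonneg h) (n1 h)
  have ht₁M : t₁ ≤ M₁ := by rw [ht₁]; nlinarith
  have hT₂M : (∑ h ∈ Finset.range (M₂ + 1), (h : ℝ) * μ₂ h) ≤ M₂ := lawMean_le_top M₂ μ₂ n2 s2
  have hT₂0 : 0 ≤ ∑ h ∈ Finset.range (M₂ + 1), (h : ℝ) * μ₂ h :=
    Finset.sum_nonneg fun h _ => mul_nonneg (Nat.cast_nonneg h) (n2 h)
  have ht₂M : t₂ ≤ M₂ := by rw [ht₂]; nlinarith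
  have ht₁pos : 0 < t₁ := by linarith
  have hkt₁ : (k : ℝ) < t₁ := by linarith
  -- ROW DATA (copied from arm-2 g38's assembly)
  let act : ℕ → Prop := fun s => s ≤ k ∧ (((k : ℝ) < t₁ + s ∧ 0 < t₁) ∨ M₂ < s)
  let c : ℕ → ℕ := fun s => if M₂ < s then k - s else min (k - s) (min (⌈t₁ / 2⌉₊ - 1) (⌈t₁ - k + s⌉₊ - 1))
  have hc_hi : ∀ s, M₂ < s → c s = k - s := fun s h => if_pos h
  have hc_lo : ∀ s, ¬ M₂ < s → c s = min (k - s) (min (⌈t₁ / 2⌉₊ - 1) (⌈t₁ - k + s⌉₊ - 1)) := fun s h => if_neg h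
  have hact : ∀ s, s ≤ k → act s := fun s hs => ⟨hs, Or.inl ⟨by have : (0:ℝ) ≤ s := Nat.cast_nonneg s; linarith, ht₁pos⟩⟩
  have hactk : ∀ s, act s → s ≤ k := fun s hs => hs.1
  have H1 : ∀ s : ℕ, act s → 2 * (c s : ℝ) < t₁ := by
    intro s ⟨hs, hor⟩
    by_cases hM : M₂ < s
    · rw [hc_hi s hM, Nat.cast_sub hs]
      have hsM : (M₂ : ℝ) < s := by exact_mod_cast hM
      linarith
    · rw [hc_lo s hM]
      rcases hor with ⟨_, ht⟩ | hM'
      · exact halfRows_H1 t₁ k s ht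
      · exact (hM hM').elim
  have H2 : ∀ s : ℕ, act s → c s + s ≤ k := by
    intro s ⟨hs, _⟩
    by_cases hM : M₂ < s
    · rw [hc_hi s hM]; omega
    · rw [hc_lo s hM]; exact halfRows_H2 t₁ k s hs
  have H3 : ∀ s : ℕ, act s → (c s : ℝ) < t₁ - k + s := by
    intro s ⟨hs, hor⟩
    by_cases hM : M₂ < s
    · rw [hc_hi s hM, Nat.cast_sub hs]
      have hsM : (M₂ : ℝ) < s := by exact_mod_cast hM
      linarith
    · rw [hc_lo s hM]
      rcases hor with ⟨hks, _⟩ | hM'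
      · exact halfRows_H3 t₁ k s hks
      · exact (hM hM').elim
  have H4 : ∀ a s : ℕ, a + s ≤ k → (¬ act s ∨ c s < a) → (t₁ ≤ 2 * (a : ℝ) ∨ t₁ - k + s ≤ (a : ℝ)) := by
    intro a s hlow hunc
    by_cases hM : M₂ < s
    · exfalso
      rcases hunc with hna | hlt
      · exact hna ⟨by omega, Or.inr hM⟩
      · rw [hc_hi s hM] at hlt; omega
    · refine halfRows_H4 t₁ k a s hlow ?_
      rcases hunc with hna | hlt
      · left
        rintro ⟨hs, hks, ht⟩
        exact hna ⟨hs, Or.inl ⟨hks, ht⟩⟩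
      · right; rw [hc_lo s hM] at hlt; exact hlt
  have Hcov : ∀ a s : ℕ, a + s ≤ k → t₂ ≤ 2 * (s : ℝ) → act s ∧ a ≤ c s := by
    intro a s hlow hhigh
    by_cases hM : M₂ < s
    · refine ⟨⟨by omega, Or.inr hM⟩, ?_⟩
      rw [hc_hi s hM]; omega
    · obtain ⟨⟨hs, hks, ht⟩, hle⟩ := halfRows_H6 t₁ t₂ k a s hk2 (by omega) hhigh hlow
      exact ⟨⟨hs, Or.inl ⟨hks, ht⟩⟩, by rw [hc_lo s hM]; exact hle⟩
  let U : ℕ → ℕ → Prop := fun a s => a + s ≤ k ∧ (¬ act s ∨ c s < a)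
  let W : ℕ → ℕ → Prop := fun a s => act s ∧ t₁ - c s ≤ (a : ℝ) ∧ k < a + s ∧ (a : ℝ) + s < t₁ + t₂ - k
  have hUW_low : ∀ a s, (U a s ∨ W a s) → 2 * (s : ℝ) < t₂ ∧ s ≤ M₂ := by
    intro a s h
    rcases h with ⟨hlow, hunc⟩ | ⟨hac, hge, _, hlt⟩
    · have h2s : 2 * (s : ℝ) < t₂ := by
        by_contra hh
        obtain ⟨hac, hle⟩ := Hcov a s hlow (not_lt.1 hh)
        rcases hunc with hna | hlt'
        · exact hna hac
        · omega
      refine ⟨h2s, ?_⟩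
      by_contra hM
      have : (M₂ : ℝ) < s := by exact_mod_cast (not_le.1 hM)
      have hsM2 : (s : ℝ) ≤ k := by exact_mod_cast (show s ≤ k by omega)
      -- `M₂ < s ≤ k` rows are phantom rows: covered by construction (c = k - s), so no U-cell there
      rcases hunc with hna | hlt'
      · exact hna ⟨by omega, Or.inr (not_le.1 hM)⟩
      · rw [hc_hi s (not_le.1 hM)] at hlt'; omega
    · have h2 := H2 s hac
      have h2' : (c s : ℝ) + s ≤ k := by exact_mod_cast h2
      have h2s : 2 * (s : ℝ) < t₂ := by linarith
      refine ⟨h2s, ?_⟩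
      by_contra hM
      have : (M₂ : ℝ) < s := by exact_mod_cast (not_le.1 hM)
      linarith
  -- COLUMN PROFILE (copied)
  set r : ℝ := (1 - y) / y with hr
  have hr0 : 0 ≤ r := div_nonneg (by linarith) hy0.le
  have hr1 : r ≤ 1 := by rw [hr, div_le_one hy0]; linarith
  obtain ⟨need, hneed⟩ : ∃ need : ℕ → ℕ → ℝ, ∀ a s : ℕ, need a s =
      (if ∃ s' ∈ Finset.Icc s M₂, U a s' then (1 : ℝ) else if ∃ s' ∈ Finset.Icc s M₂, W a s' then r else 0) :=
    ⟨fun a s => if ∃ s' ∈ Finset.Icc s M₂, U a s' then (1 : ℝ) else if ∃ s' ∈ Finset.Icc s M₂, W a s' then r else 0,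
      fun a s => rfl⟩
  have N0 : ∀ a s : ℕ, 0 ≤ need a s := fun a s => by
    rw [hneed]; convert need_nonneg U W r M₂ a s hr0 using 5
  have N1 : ∀ a s : ℕ, need a s ≤ 1 := fun a s => by
    rw [hneed]; convert need_le_one U W r M₂ a s hr1 using 5
  have NU : ∀ a s : ℕ, a + s ≤ k → (¬ act s ∨ c s < a) → need a s = 1 := by
    intro a s hlow hunc
    rw [hneed]
    convert need_eq_one_of_U U W r M₂ a s (hUW_low a s (Or.inl ⟨hlow, hunc⟩)).2 ⟨hlow, hunc⟩ using 5
  have NW : ∀ a s : ℕ, act s → t₁ - c s ≤ (a : ℝ) → k < a + s → (a : ℝ) + s < t₁ + t₂ - k → (1 - y) / y ≤ need a s := by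
    intro a s hac hge hks hlt
    rw [hneed]
    convert need_ge_of_W U W r M₂ a s hr1 (hUW_low a s (Or.inr ⟨hac, hge, hks, hlt⟩)).2 ⟨hac, hge, hks, hlt⟩ using 5
  have Npos : ∀ a s : ℕ, 0 < need a s → ∃ s'', s ≤ s'' ∧ (U a s'' ∨ W a s'') := by
    intro a s hpos
    rw [hneed] at hpos
    exact need_pos_witness U W r M₂ a s (by convert hpos using 5)
  have Nmono : ∀ a s : ℕ, need a (s + 1) ≤ need a s := fun a s => by
    rw [hneed, hneed]
    convert need_antitone U W r M₂ a s (s + 1) hr0 hr1 (Nat.le_succ s) using 5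
  have Nvan : ∀ a s : ℕ, M₂ < s → need a s = 0 := fun a s hs => by
    rw [hneed]; convert need_eq_zero_of_lt U W r M₂ a s hs using 5
  have Nval : ∀ a cc : ℕ, need a (cc + 1) < need a cc → 2 * (cc : ℝ) < t₂ := by
    intro a cc hlt
    have hne' : (if ∃ s' ∈ Finset.Icc cc M₂, U a s' then (1 : ℝ) else if ∃ s' ∈ Finset.Icc cc M₂, W a s' then r else 0)
        ≠ (if ∃ s' ∈ Finset.Icc (cc + 1) M₂, U a s' then (1 : ℝ) else if ∃ s' ∈ Finset.Icc (cc + 1) M₂, W a s' then r else 0) := by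
      intro h
      have hz : need a cc = need a (cc + 1) := by rw [hneed, hneed]; convert h using 4
      rw [hz] at hlt; exact lt_irrefl _ hlt
    have hcell := need_drop_witness U W r M₂ a cc (by convert hne' using 5)
    exact (hUW_low a cc hcell).1
  have Npos' : ∀ a s : ℕ, 0 < need a s → ∃ s'' : ℕ, (a : ℝ) + s'' < t₁ + t₂ - k := by
    intro a s hpos
    obtain ⟨s'', _, hcell⟩ := Npos a s hpos
    rcases hcell with ⟨hlow, _⟩ | ⟨_, _, _, hlt⟩
    · refine ⟨s'', ?_⟩
      have hlow' : ((a + s'' : ℕ) : ℝ) ≤ k := by exact_mod_cast hlow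
      push_cast at hlow'
      linarith
    · exact ⟨s'', hlt⟩
  -- S*'s pointwise inequality at every cell
  have hS : ∀ a ∈ Finset.range (M₁ + 1), ∀ s ∈ Finset.range (M₂ + 1),
      (if act s then (1 - y) * (if t₁ - c s ≤ (a : ℝ) then (1 : ℝ) else 0) - y * (if a ≤ c s then (1 : ℝ) else 0) else 0)
        + (1 - y) * need a ⌈t₂ - s⌉₊ - y * need a s
        ≤ (1 - y) * (if t₁ + t₂ - k ≤ (a : ℝ) + s then (1 : ℝ) else 0) - y * (if a + s ≤ k then (1 : ℝ) else 0) := by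
    intro a _ s _
    exact halfCert_pointwise y t₁ t₂ k a s hy hy1 hk2 act c H1 H2 H3 H4 need N0 N1 NU NW Npos
  -- package and apply the principle with zero tilts
  obtain ⟨lam, kap, hl0, hlv, hk0', hkv, hE0, hE1⟩ :=
    regimeR_certificate_of_pointwise y t₁ t₂ M₁ M₂ k hy hy1 ht₁pos ht₁M hR act c hact hactk H1 need N0 Nvan Nmono Nval Npos' hS
  refine gate_lconv_row_of_universalCertificate y q t₁ t₂ M₁ M₂ k μ₁ μ₂ hy0 hy1 hq0 hq1 n1 z1 s1 n2 z2 s2 ht₁ ht₂ hk2 hB1 hB2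
    lam kap (fun _ => 0) (fun _ => 0) hl0 hlv hk0' hkv ?_ ?_
  · intro a ha s hs
    have := hE0 a ha s hs
    simpa only [zero_mul, add_zero] using this
  · intro a ha s hs
    have := hE1 a ha s hs
    simpa only [mul_zero, add_zero] using this

end LawDec

end Quant

end Summit.CriticalPhenomena.PercolationContinuityZ3.Theorems
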